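import Literature.GroupTheory.FiniteActionProfiniteCompletion
import Literature.AnabelianGeometry.AbsoluteAnabelian.AbsTopIII.AutHolLogFrobeniusGaloisCenterFree
import Literature.AnabelianGeometry.AbsoluteAnabelian.SlimIdRigid
import Literature.AnabelianGeometry.AbsoluteAnabelian.RigidFunctors
import Literature.AnabelianGeometry.SemiGraphs.ProSigmaCompletionModels
import Mathlib.CategoryTheory.Comma.Over.Basic
import HarnessLib

/-!
# Id-rigidity of finite `G`-sets and of their slices, through the profinite completion `Ĝ`

PROOF-ONLY companion (abc-iut cell, campaign-L R1 STEP 3 (3γ), support of GAP row G-L4t14-R1; seat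
abc-iut-f-072).  [AbsTopIII] Prop. 4.2 (i) p. 106 l. 14–19 / Lemma 4.3 p. 106 route the id-rigidity of
the geometric `EA` through «`Loc(X)` is id-rigid by the slimness of `Π_X`»; [SemiAnbd] §0 p. 6: "`B(G)` is
slim iff `Z_G(H) = 1` for every open `H`".  At the level of FINITE `π₁`-sets (`π₁` DISCRETE) the group that
matters is the PROFINITE COMPLETION: transporting along abc-iut-w5-d144's
`FiniteActionCompletion.equivalence G : Action FintypeCat G ≌ ContAction FintypeCat Ĝ` (= `B(Ĝ)`) we get

* `isIdRigid_action_fintypeCat_iff_center_eq_bot` — finite `G`-sets are id-rigid **iff `Z(Ĝ) = 1`**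
  (abc-iut-w6-d025's `isIdRigid_bCat_iff_center_eq_bot` at the compact group `Ĝ`; for a discrete `G` the
  invariant is `Z(Ĝ)`, not `Z(G)`);
* `isIdRigid_over_of_equivalence` — slices transport along equivalences (Mathlib `Over.postEquiv`);
* `isIdRigid_over_action_fintypeCat_of_isSlim_bCat` / `…_of_isSlimGroup` — **every slice `(finite G-sets)_{/A}`
  is id-rigid when `B(Ĝ)` is slim / `Ĝ` is slim** (the «finite étale objects over a varying base» shape of
  [AbsTopIII] §0 p. 27, tree `isIdRigid_over_of_isSlim` / `isIdRigid_over_bCat_of_isSlimGroup`);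
* unconditional instances at hyperbolic punctured surface groups `Γ_{g,r}` (F-0037
  `proSigmaSurfaceGroupSlim_holds` at `Γ̂_{g,r}`) and the calibration `G = ℤ` (finite `ℤ`-sets are NOT
  id-rigid: `Ẑ` is abelian ≠ 1).

No definition, no named fact; nothing here bears on [IUTchIII] Cor. 3.12.
-/

noncomputable section

open CategoryTheory
open scoped FintypeCatDiscrete

universe v u

namespace Literature.AnabelianGeometry.AbsoluteAnabelian

open Literature.GroupTheory Literature.IUT.HodgeTheaters Literature.IUT.HodgeTheaters.ProfiniteCompletion
open Literature.AlgebraicGeometry.Frobenioids Literature.AnabelianGeometry.SemiGraphs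
open Literature.GroupTheory.CombinatorialGroupTheory

/-! ### Slices transport along equivalences -/

/-- Id-rigidity of slices is invariant under equivalence: if `e : C ≌ D` and the slice of `D` over
`e X` is id-rigid, so is the slice of `C` over `X` (Mathlib `Over.postEquiv`; same universes, as the tree's
`IsRigidFunctor` requires).
[cite: MochizukiAbsTopIII2015, Section 0 p.27] -/
theorem isIdRigid_over_of_equivalence {C : Type u} [Category.{v} C] {D : Type u} [Category.{v} D]
    (e : C ≌ D) (X : C) (h : IsIdRigid (Over (e.functor.obj X))) : IsIdRigid (Over X) :=
  isIdRigid_of_equivalence (Over.postEquiv X e) h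

/-! ### Finite `G`-sets: id-rigid iff `Z(Ĝ) = 1` -/

/-- **Finite `G`-sets are id-rigid IFF the profinite completion `Ĝ` is centre-free** (for a discrete
group `G`; `B(Ĝ)` id-rigid iff `Z(Ĝ) = 1`, transported along `Action FintypeCat G ≌ B(Ĝ)`).
[cite: MochizukiSemiAnbd2006, Section 0 p.6] -/
theorem isIdRigid_action_fintypeCat_iff_center_eq_bot (G : Type u) [Group G] :
    IsIdRigid (Action FintypeCat.{u} G) ↔ Subgroup.center (profiniteCompletion G) = ⊥ := by
  rw [← isIdRigid_bCat_iff_center_eq_bot (G := profiniteCompletion G)]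
  exact ⟨fun h => isIdRigid_of_equivalence' (FiniteActionCompletion.equivalence G) h,
    fun h => isIdRigid_of_equivalence (FiniteActionCompletion.equivalence G) h⟩

/-- Finite `G`-sets are id-rigid when `Ĝ` is slim ([AbsTopIII] Lemma 4.3's input, read at the level of
finite `π₁`-sets; slim ⟹ centre-free). [cite: MochizukiAbsTopIII2015, Lemma 4.3 p.106] -/
theorem isIdRigid_action_fintypeCat_of_isSlimGroup (G : Type u) [Group G]
    (h : IsSlimGroup (profiniteCompletion G)) : IsIdRigid (Action FintypeCat.{u} G) := by
  refine (isIdRigid_action_fintypeCat_iff_center_eq_bot G).mpr ?_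
  have h1 := h.centralizer_eq_bot ⊤ isOpen_univ
  rwa [Subgroup.coe_top, Subgroup.centralizer_univ] at h1

/-! ### Slices of finite `G`-sets -/

/-- **Every slice of the category of finite `G`-sets is id-rigid when `B(Ĝ)` is slim** (universe-
polymorphic form; hypothesis = slimness of the category `B(Ĝ)`). [cite: MochizukiAbsTopIII2015, Section 0 p.27] -/
theorem isIdRigid_over_action_fintypeCat_of_isSlim_bCat (G : Type u) [Group G]
    (h : IsSlim (BCat (profiniteCompletion G))) (A : Action FintypeCat.{u} G) : IsIdRigid (Over A) :=
  isIdRigid_over_of_equivalence (FiniteActionCompletion.equivalence G) A (isIdRigid_over_of_isSlim h _)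

/-- **Every slice of the category of finite `G`-sets is id-rigid when `Ĝ` is slim** ([SemiAnbd] §0:
`B(Ĝ)` slim iff `Ĝ` slim — the tree's named fact `bCat_isSlim_iff_isSlimGroup`, proved, is stated at
`G : Type`, whence universe `0` here). [cite: MochizukiAbsTopIII2015, Section 0 p.27] -/
theorem isIdRigid_over_action_fintypeCat_of_isSlimGroup (G : Type) [Group G]
    (h : IsSlimGroup (profiniteCompletion G)) (A : Action FintypeCat.{0} G) : IsIdRigid (Over A) :=
  isIdRigid_over_of_equivalence (FiniteActionCompletion.equivalence G) A
    (isIdRigid_over_bCat_of_isSlimGroup _ h _)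

/-! ### Instances: hyperbolic surface groups; calibration at `ℤ` -/

/-- `Γ̂_{g,r}` is slim for hyperbolic `(g, r)` (F-0037 `proSigmaSurfaceGroupSlim_holds` at the profinite
completion, `isProSigmaCompletion_toCompletion`). [cite: MochizukiAbsAnab2004, Lemma 1.3.1 p.15] -/
theorem isSlimGroup_profiniteCompletion_puncturedSurfaceGroup {g r : ℕ}
    (hgr : PuncturedSurfaceGroup.IsHyperbolicType g r) :
    IsSlimGroup (profiniteCompletion (PuncturedSurfaceGroup g r)) :=
  proSigmaSurfaceGroupSlim_holds {p : ℕ | p.Prime} ⟨2, Nat.prime_two⟩ (fun _ hp => hp) g r hgr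
    (profiniteCompletion (PuncturedSurfaceGroup g r)) (toCompletion _)
    (SemiGraphOfAnabelioids.IsProSigmaCompletion.isProSigmaCompletion_toCompletion _)

/-- **Hyperbolic punctured surface groups**: finite `Γ_{g,r}`-sets (`2g − 2 + r > 0`) form an id-rigid
category. [cite: MochizukiAbsAnab2004, Lemma 1.3.1 p.15] -/
theorem isIdRigid_action_fintypeCat_puncturedSurfaceGroup {g r : ℕ}
    (hgr : PuncturedSurfaceGroup.IsHyperbolicType g r) :
    IsIdRigid (Action FintypeCat.{0} (PuncturedSurfaceGroup g r)) :=
  isIdRigid_action_fintypeCat_of_isSlimGroup _ (isSlimGroup_profiniteCompletion_puncturedSurfaceGroup hgr)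

/-- … and so does every slice of it («finite étale objects over a varying base»).
[cite: MochizukiAbsTopIII2015, Section 0 p.27] -/
theorem isIdRigid_over_action_fintypeCat_puncturedSurfaceGroup {g r : ℕ}
    (hgr : PuncturedSurfaceGroup.IsHyperbolicType g r) (A : Action FintypeCat.{0} (PuncturedSurfaceGroup g r)) :
    IsIdRigid (Over A) :=
  isIdRigid_over_action_fintypeCat_of_isSlimGroup _ (isSlimGroup_profiniteCompletion_puncturedSurfaceGroup hgr) A

/-- Calibration: finite `ℤ`-sets are NOT id-rigid (`Ẑ` is abelian and nontrivial — the generator is a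
nonzero central element, nonzero already mod `2`). [cite: MochizukiSemiAnbd2006, Section 0 p.6] -/
theorem not_isIdRigid_action_fintypeCat_multiplicative_int :
    ¬ IsIdRigid (Action FintypeCat.{0} (Multiplicative ℤ)) := by
  rw [isIdRigid_action_fintypeCat_iff_center_eq_bot, Subgroup.eq_bot_iff_forall]
  intro h
  -- `Ẑ` is commutative: componentwise in the commutative quotients `ℤ/N`
  have hcomm : ∀ x y : profiniteCompletion (Multiplicative ℤ), x * y = y * x := by
    intro x y
    apply Subtype.ext
    funext N
    change (x.val N : Multiplicative ℤ ⧸ N.toSubgroup) * (y.val N : Multiplicative ℤ ⧸ N.toSubgroup) =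
      (y.val N : Multiplicative ℤ ⧸ N.toSubgroup) * (x.val N : Multiplicative ℤ ⧸ N.toSubgroup)
    obtain ⟨a, ha⟩ := QuotientGroup.mk_surjective (x.val N : Multiplicative ℤ ⧸ N.toSubgroup)
    obtain ⟨b, hb⟩ := QuotientGroup.mk_surjective (y.val N : Multiplicative ℤ ⧸ N.toSubgroup)
    rw [← ha, ← hb]
    change ((a * b : Multiplicative ℤ) : Multiplicative ℤ ⧸ N.toSubgroup) =
      ((b * a : Multiplicative ℤ) : Multiplicative ℤ ⧸ N.toSubgroup)
    rw [mul_comm]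
  -- the image of the generator is central …
  let z : profiniteCompletion (Multiplicative ℤ) := toCompletion _ (Multiplicative.ofAdd 1)
  have hz : z ∈ Subgroup.center (profiniteCompletion (Multiplicative ℤ)) := by
    rw [Subgroup.mem_center_iff]; intro y; exact hcomm y z
  have hz1 := h z hz
  -- … and nontrivial: evaluate at the subgroup `2ℤ`
  let H : Subgroup (Multiplicative ℤ) := (AddSubgroup.zmultiples (2 : ℤ)).toSubgroup
  haveI : H.FiniteIndex := by
    refine ⟨?_⟩
    change (AddSubgroup.zmultiples (2 : ℤ)).toSubgroup.index ≠ 0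
    rw [AddSubgroup.index_toSubgroup, Int.index_zmultiples]; decide
  let N : FiniteIndexNormalSubgroup (Multiplicative ℤ) := FiniteIndexNormalSubgroup.ofSubgroup H
  have hN : z.val N = (QuotientGroup.mk (Multiplicative.ofAdd (1 : ℤ)) : Multiplicative ℤ ⧸ N.toSubgroup) :=
    toCompletion_val _ N
  rw [hz1] at hN
  change (1 : Multiplicative ℤ ⧸ N.toSubgroup) = _ at hN
  rw [eq_comm, QuotientGroup.eq_one_iff] at hN
  change Multiplicative.ofAdd (1 : ℤ) ∈ (AddSubgroup.zmultiples (2 : ℤ)).toSubgroup at hN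
  rw [Multiplicative.mem_toSubgroup, toAdd_ofAdd, Int.mem_zmultiples_iff] at hN
  omega

end Literature.AnabelianGeometry.AbsoluteAnabelian
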